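import Literature.Topology.FourManifolds.MMSWRasmussenGeneralPosition
import HarnessLib

/-!
# The model boundary `M_r = {G_r = 1}` is a regular level set

A corollary file of `Literature/Topology/FourManifolds/MMSWRasmussenGeneralPosition.lean`, which
proves that the planar half-gradient of the level function `G_r` of the model
`M_r = ∂D_r ⊂ ℝ⁴` of `#ʳ(S¹ × S²)` (`MMSWRasmussen.lean`) does not vanish on `{g_r ≥ 19/20}`
(`MMSW.gradSq_pos`, a four-zone estimate) and computes `dG_r` (`MMSW.fderiv_levelFun_apply`).
Here the two are assembled into the statement downstream general-position, tubular-neighbourhood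
and implicit-function arguments in the model actually consume, and which the docstring of
`MMSW.modelBoundary` asserts ("a closed smooth hypersurface of `ℝ⁴`: the critical values of `G_r`
are `< 1`"): **at every point of `M_r` the differential of `G_r` is nonzero, hence onto `ℝ`, and
`G_r` is strictly differentiable there** — `1` is a regular value of `G_r` along `M_r`
(Guillemin–Pollack, Ch. 1 §4: the preimage of a regular value is a submanifold of codimension one).

Proof: if `dG_r(y) = 0` then its values `2y₂`, `2y₃` on `e₂`, `e₃` vanish, so `w = 0` and
`g_r(z) = G_r(y) = 1 ≥ 19/20`; and its values on `e₀`, `e₁` are twice the planar half-gradient,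
which is nonzero there by `gradSq_pos`.  Everything is proved; no definitions, no named facts.

## References

* C. Manolescu, M. Marengon, S. Sarkar, M. Willis, Duke Math. J. 172 (2023), arXiv:1910.08195,
  §2.1 and §8.1 (the manifold `M_r`). [ManolescuMarengonSarkarWillis2023]
* V. Guillemin, A. Pollack, *Differential Topology*, Prentice–Hall (1974), Ch. 1 §4. [folklore]
* M. W. Hirsch, *Differential Topology*, GTM 33 (1976), Ch. 1 Thm. 3.2 (regular value theorem).
  [HirschDT1976]
-/

open scoped ContDiff
open Function Set

noncomputable section

namespace Literature.Topology.FourManifolds.MMSW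

variable {r : ℕ}

/-- On `M_r` the hole terms do not vanish (the guard `|z - c_j|² ≥ 1`). [folklore] -/
theorem holeTerm_ne_zero_of_mem_modelBoundary {y : EuclideanSpace ℝ (Fin 4)}
    (hy : y ∈ modelBoundary r) (j : Fin r) : holeTerm r j y ≠ 0 := fun h ↦ by
  have := hy.1 j
  rw [h] at this
  norm_num at this

/-- **`1` is a regular value of `G_r` along `M_r`**: the differential of the level function does
not vanish at any point of the model boundary. [cite: HirschDT1976, Ch. 1 Thm. 3.2] -/
theorem fderiv_levelFun_ne_zero {y : EuclideanSpace ℝ (Fin 4)} (hy : y ∈ modelBoundary r) :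
    fderiv ℝ (levelFun r) y ≠ 0 := by
  intro h0
  have hh := holeTerm_ne_zero_of_mem_modelBoundary hy
  have hv : ∀ v : EuclideanSpace ℝ (Fin 4),
      2 * ((y 0 / (40 * ((r : ℝ) + 1)) ^ 2 -
        ∑ j : Fin r, (y 0 - 4 * (((j : ℕ) : ℝ) + 1)) / holeTerm r j y ^ 2) * v 0 +
        (y 1 / (40 * ((r : ℝ) + 1)) ^ 2 - ∑ j : Fin r, y 1 / holeTerm r j y ^ 2) * v 1 +
        y 2 * v 2 + y 3 * v 3) = 0 := fun v ↦ by
    rw [← fderiv_levelFun_apply hh v, h0]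
    rfl
  have h2 : y 2 = 0 := by simpa using hv (EuclideanSpace.single 2 1)
  have h3 : y 3 = 0 := by simpa using hv (EuclideanSpace.single 3 1)
  have hRe : y 0 / (40 * ((r : ℝ) + 1)) ^ 2 -
      ∑ j : Fin r, (y 0 - 4 * (((j : ℕ) : ℝ) + 1)) / holeTerm r j y ^ 2 = 0 := by
    simpa using hv (EuclideanSpace.single 0 1)
  have hIm : y 1 / (40 * ((r : ℝ) + 1)) ^ 2 - ∑ j : Fin r, y 1 / holeTerm r j y ^ 2 = 0 := by
    simpa using hv (EuclideanSpace.single 1 1)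
  have hg : 19 / 20 ≤ levelFun r y - ((y 2) ^ 2 + (y 3) ^ 2) := by
    rw [hy.2, h2, h3]
    norm_num
  have hpos := gradSq_pos hh hg
  rw [hRe, hIm] at hpos
  norm_num at hpos

/-- Hence **the differential of `G_r` at a point of `M_r` is onto `ℝ`** (the hypothesis of the
implicit function theorem). [folklore] -/
theorem fderiv_levelFun_surjective {y : EuclideanSpace ℝ (Fin 4)} (hy : y ∈ modelBoundary r) :
    Function.Surjective (fderiv ℝ (levelFun r) y) := by
  obtain ⟨v, hv⟩ : ∃ v, fderiv ℝ (levelFun r) y v ≠ 0 := by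
    by_contra h
    push Not at h
    exact fderiv_levelFun_ne_zero hy (ContinuousLinearMap.ext fun v ↦ by rw [h v]; simp)
  intro c
  refine ⟨(c / fderiv ℝ (levelFun r) y v) • v, ?_⟩
  rw [map_smul, smul_eq_mul, div_mul_cancel₀ c hv]

/-- The range of the differential of `G_r` at a point of `M_r` is all of `ℝ` (the form used by
`HasStrictFDerivAt.implicitFunction`). [folklore] -/
theorem range_fderiv_levelFun_eq_top {y : EuclideanSpace ℝ (Fin 4)} (hy : y ∈ modelBoundary r) :
    LinearMap.range (fderiv ℝ (levelFun r) y : EuclideanSpace ℝ (Fin 4) →ₗ[ℝ] ℝ) = ⊤ :=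
  LinearMap.range_eq_top.2 fun c ↦ fderiv_levelFun_surjective hy c

/-- `G_r` is strictly differentiable off the poles, in particular at every point of `M_r`.
[folklore] -/
theorem hasStrictFDerivAt_levelFun {y : EuclideanSpace ℝ (Fin 4)} (hy : ∀ j, holeTerm r j y ≠ 0) :
    HasStrictFDerivAt (levelFun r) (fderiv ℝ (levelFun r) y) y :=
  (contDiffAt_levelFun hy).hasStrictFDerivAt (by simp)

end Literature.Topology.FourManifolds.MMSW

end
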